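import Literature.Probability.LatticeModels.WeakBeurlingHoleFree
import Literature.Probability.LatticeModels.ExteriorLatticePath
import Literature.Probability.LatticeModels.FKPrimitiveBounds
import HarnessLib

/-!
# Boundary estimates for the FK primitive near the arcs (Smirnov 2010, Thm. 5.3 / Lemma B.3 step for `H`)

Topic `Literature/Probability/LatticeModels`; an instalment (item B3, lattice part, of the road
recorded in `Sweep1Proofs.lean`, module docstring §2b) of the discharge programme for
crit-ising.S18 / Smirnov's Theorem 2.2. Smirnov 2010, §5 (proof of Theorem 5.3; the argument of
Lemma B.3 applied to `H`): near a point of the arc `(ab)` away from `b`, the black primitive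
`H_b` is subharmonic, equals `H_A` on the arc and is a priori at most `H_A + 1`; the sites of
`∂Ω_δ` inside a small ball all lie on the wired arc, where the flux is small (Theorem 5.1 a priori
bound, fed in as `η₁`), so the two-constant/weak-Beurling comparison gives
`H_b - H_A ≤ η₁ + (1 - c_*)^J` well inside the ball; symmetrically `H_B - H_w ≤ η₁ + (1 - c_*)^J`
near the free arc with the superharmonic white primitive.

* `sub_le_eta_add_pow` — the generic comparison: `u` subharmonic on `S₀`, `≤ 1` on `S₀` and at
  the outer neighbours off the ball `Bl`, `≤ η₁` at the outer neighbours inside `Bl`; with a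
  hole-free `K ⊇ S₀ ∩ Bl` and a site `F₀ ∉ K` near the evaluation point,
  `u ≤ η₁ + (1 - c_*)^J` (harmonic majorant `harmExt` of `HarmonicExtension.lean` plus the
  hole-free weak Beurling estimate `weakBeurling_of_holeFree` of `WeakBeurlingHoleFree.lean`).
  This is the same two-constant mechanism as the tree's `le_add_rpow_of_cutPath`
  (`LatticeHarmonicMeasure.lean`, built on `WeakBeurlingEstimate.lean`); the present form takes
  the hole-free certificate `K = (ExtConn D δ)ᶜ` of `ExteriorLatticePath.lean` and the explicit
  scale form `(1 - maneuverConst)^J`, which is how `BoundaryValues.lean` consumes it.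
* `hb_sub_le_near_arcA`, `hw_sub_le_near_arcA` — the `A`-side for FK primitives
  (`IsFKPrimitive`, `FKPrimitiveBounds.lean`: `Hb` subharmonic on interior faces, `hb_mem_Icc`,
  `Hw v = Hb f - flux ≤ Hb f`); `sub_hw_le_near_arcB` — the `B`-side with `u = H_B - Hw`
  (`Hw` superharmonic on interior sites); helpers `hb_le_of_not_interiorFace`,
  `hw_ge_of_not_interiorSite(')`, `isInnerFace_faceAt_of_neighbour`,
  `isInnerFace_faceAt_of_not_mem_zdBoundary`.

Everything is proved.

## References

* S. Smirnov, Ann. of Math. 172 (2010) 1435–1467, §5 (Thm. 5.3) and App. B, Lemma B.3 — bib key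
  `Smirnov2010`.
-/

noncomputable section

namespace Literature.Probability.LatticeModels

open WeakBeurling (sqBox sqBox_mono mem_sqBox_succ_of_adj)
open Set Metric

/-! ### The generic boundary estimate: comparison plus weak Beurling -/

open scoped Classical in
/-- **Generic boundary estimate.** Let `u` be subharmonic on `S₀`, at most `1` on `S₀` and at the
sites adjacent to `S₀ ∩ Bl` outside the ball `Bl`, and at most `η₁` at the sites of `Bl` adjacent to
`S₀ ∩ Bl` but outside `S₀`. Let `K` be
hole-free with `S₀ ∩ Bl ⊆ K`, let a face `F₀ ∉ K` and the evaluation point `x ∈ S₀ ∩ Bl` lie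
within `12k₀` of `c`, and let `sqBox c R ⊆ Bl` with `10 · 5^J k₀ ≤ R`. Then
`u x ≤ η₁ + (1 - c_*)^J`. [cite: Smirnov2010, §5 and Lemma B.3 (boundary values of H)] -/
theorem sub_le_eta_add_pow {S₀ Bl K : Set (Site 2)} {u : Site 2 → ℝ} (hsub : IsLatticeSubharmonicOn u S₀)
    {η₁ : ℝ} (hη₁ : 0 ≤ η₁)
    (hbd : ∀ w, w ∉ S₀ → (∃ v ∈ S₀ ∩ Bl, ∃ e : Fin 4, w = v + cornerUnit e) → u w ≤ if w ∈ Bl then η₁ else 1)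
    (hbd' : ∀ w ∈ S₀, u w ≤ 1)
    (hBl : (S₀ ∩ Bl).Finite) (hK : HoleFree K) (hSK : S₀ ∩ Bl ⊆ K)
    (c : Site 2) {k₀ : ℕ} (hk₀ : 0 < k₀) {F₀ : Site 2} (hF₀ : F₀ ∉ K) (hF₀c : F₀ ∈ mB c k₀)
    {R : ℤ} (hR : sqBox c R ⊆ Bl) (J : ℕ) (hJ : 10 * 5 ^ J * (k₀ : ℤ) ≤ R)
    {x : Site 2} (hx : x ∈ S₀ ∩ Bl) (hxc : x ∈ mB c k₀) :
    u x ≤ η₁ + (1 - maneuverConst) ^ J := by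
  classical
  set S := S₀ ∩ Bl with hS
  set g : Site 2 → ℝ := fun y => if y ∈ Bl then 0 else 1 with hg
  set HM := harmExt S g with hHM
  -- comparison: `u - η₁ ≤ HM` on `S`
  have hcomp : ∀ y ∈ S, u y - η₁ ≤ HM y := by
    intro y hy
    have h := le_of_sub_super_of_boundary hBl (H₁ := fun y => u y - η₁) (H₂ := HM)
      (by
        intro v hv
        rw [show (fun y => u y - η₁) = fun y => u y + -η₁ from rfl, latticeLaplacian_add_const]
        exact hsub v hv.1)
      (harmExt_harmonicOn hBl g).superharmonicOn (c := 0) (fun w hw => ?_) y hy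
    · simpa using h
    · obtain ⟨hwS, v, hv, e, rfl⟩ := hw
      rw [add_zero, hHM, harmExt_of_not_mem hBl g hwS, hg]
      simp only
      by_cases hwS₀ : v + cornerUnit e ∈ S₀
      · -- then `w ∉ Bl`, `g w = 1 ≥ u w - η₁`
        have hwBl : v + cornerUnit e ∉ Bl := fun h' => hwS ⟨hwS₀, h'⟩
        simp only [hwBl, if_false]
        linarith [hbd' (v + cornerUnit e) hwS₀]
      · have key := hbd _ hwS₀ ⟨v, hv, e, rfl⟩
        split_ifs at key ⊢ with hwBl <;> linarith
  -- weak Beurling for `HM`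
  have h01 : ∀ y, 0 ≤ HM y ∧ HM y ≤ 1 := fun y =>
    ⟨le_harmExt' hBl (fun w => by simp only [hg]; split_ifs <;> norm_num) y,
      harmExt_le' hBl (fun w => by simp only [hg]; split_ifs <;> norm_num) y⟩
  have hzero : ∀ y ∈ sqBox c R, y ∉ S → HM y = 0 := by
    intro y hy hyS
    rw [hHM, harmExt_of_not_mem hBl g hyS, hg]; simp [hR hy]
  have hharm : IsLatticeHarmonicOn HM (S ∩ sqBox c R) := fun y hy => harmExt_harmonicOn hBl g y hy.1
  have hWB := weakBeurling_of_holeFree hK hSK c hk₀ hF₀ hF₀c hharm h01 hzero J hJ hxc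
  linarith [hcomp x hx]

/-! ### The FK primitive near the arc `A`: `Hb` and `Hw` are close to `H_A` -/

section ArcA

variable {E : DiscreteDobrushin} [Fintype (meshDomain E.Ω E.δ)] {hE : E.IsZdAdmissible} {Hw Hb : Site 2 → ℝ}

/-- **A non-interior inner face without `B`-corners and with small fluxes has `Hb ≤ H_A + η₁`**:
it corners an `A`-site `v` (`exists_corner_mem_arcs_of_not_interiorFace`), where `Hw v = H_A`,
and `Hb f = Hw v + flux`. [cite: Smirnov2010, §5 (boundary values of H near (ab))] -/
theorem hb_le_of_not_interiorFace (h : IsFKPrimitive E hE Hw Hb)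
    (hcA : ∀ a' ∈ E.zdArcA, (∃ k, E.IsInnerFace (faceAt a' k)) → Hw a' = Hw (DiscreteDobrushin.startCorner hE).1)
    {f : Site 2} (hf : E.IsInnerFace f) (hint : f ∉ E.interiorFaces) (hB : ∀ j : Fin 4, f + cornerOff j ∉ E.zdArcB)
    {η₁ : ℝ} (hflux : ∀ j : Fin 4, dartFlux E hE (f + cornerOff j, j) ≤ η₁) :
    Hb f ≤ Hw (DiscreteDobrushin.startCorner hE).1 + η₁ := by
  obtain ⟨j, hj⟩ := E.exists_corner_mem_arcs_of_not_interiorFace hE hf hint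
  have hjA : f + cornerOff j ∈ E.zdArcA := hj.resolve_right (hB j)
  have hfj : E.IsInnerFace (cFace ((f + cornerOff j, j) : Site 2 × Fin 4)) := by
    change E.IsInnerFace (faceAt (f + cornerOff j) j); rw [faceAt_add_cornerOff]; exact hf
  have hp := h (f + cornerOff j, j) hfj
  simp only [cFace, faceAt_add_cornerOff] at hp
  have hv : Hw (f + cornerOff j) = Hw (DiscreteDobrushin.startCorner hE).1 :=
    hcA _ hjA ⟨j, by rw [faceAt_add_cornerOff]; exact hf⟩
  linarith [hflux j]

/-- **`Hb - H_A ≤ η₁ + (1 - c_*)^J` on the inner faces near the arc `A`.** Hypotheses at one mesh: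
an FK primitive constant on the `A`- and `B`-sites; a set of faces `Bl` ("the ball") such that no
face of `Bl` corners a `B`-site and all darts of faces of `Bl` have flux `≤ η₁`; a hole-free `K`
containing the interior faces of `Bl`, a face `F₀ ∉ K`, a centre `c` and scales `k₀, R, J` with
`sqBox c R ⊆ Bl`, `10·5^J k₀ ≤ R`, `F₀` and the evaluation face within `12k₀` of `c`.
[cite: Smirnov2010, §5 and Lemma B.3] -/
theorem hb_sub_le_near_arcA (h : IsFKPrimitive E hE Hw Hb)
    (hA : ((discreteDomainGraph E.Ω E.δ).induce E.zdArcA).Preconnected)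
    (hcA : ∀ a' ∈ E.zdArcA, (∃ k, E.IsInnerFace (faceAt a' k)) → Hw a' = Hw (DiscreteDobrushin.startCorner hE).1)
    (hcB : ∀ b ∈ E.zdArcB, (∃ k, E.IsInnerFace (faceAt b k)) →
      Hw b = Hw ((DiscreteDobrushin.startCorner hE).1 + cornerUnit (DiscreteDobrushin.startCorner hE).2))
    {Bl : Set (Site 2)} (hBlfin : (E.interiorFaces ∩ Bl).Finite)
    (hB : ∀ f ∈ Bl, ∀ j : Fin 4, f + cornerOff j ∉ E.zdArcB)
    {η₁ : ℝ} (hη₁ : 0 ≤ η₁) (hflux : ∀ f ∈ Bl, E.IsInnerFace f → ∀ j : Fin 4, dartFlux E hE (f + cornerOff j, j) ≤ η₁)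
    {K : Set (Site 2)} (hK : HoleFree K) (hSK : E.interiorFaces ∩ Bl ⊆ K)
    (c : Site 2) {k₀ : ℕ} (hk₀ : 0 < k₀) {F₀ : Site 2} (hF₀ : F₀ ∉ K) (hF₀c : F₀ ∈ mB c k₀)
    {R : ℤ} (hR : sqBox c R ⊆ Bl) (J : ℕ) (hJ : 10 * 5 ^ J * (k₀ : ℤ) ≤ R)
    {f : Site 2} (hf : E.IsInnerFace f) (hfBl : f ∈ Bl) (hfc : f ∈ mB c k₀) :
    Hb f - Hw (DiscreteDobrushin.startCorner hE).1 ≤ η₁ + (1 - maneuverConst) ^ J := by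
  classical
  set HA := Hw (DiscreteDobrushin.startCorner hE).1 with hHA
  have hjump := h.jump_startCorner
  by_cases hint : f ∈ E.interiorFaces
  · refine sub_le_eta_add_pow (S₀ := E.interiorFaces) (Bl := Bl) (u := fun g => Hb g - HA)
      (by
        intro g hg
        rw [show (fun g => Hb g - HA) = fun g => Hb g + -HA from rfl, latticeLaplacian_add_const]
        exact h.subharmonicOn_interiorFaces hA g hg)
      hη₁ (fun w hwS hwadj => ?_) (fun w hw => ?_) hBlfin hK hSK c hk₀ hF₀ hF₀c hR J hJ ⟨hint, hfBl⟩ hfc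
    · obtain ⟨v, hv, e, rfl⟩ := hwadj
      have hwin : E.IsInnerFace (v + cornerUnit e) := E.isInnerFace_add_cornerUnit_of_interiorFace hv.1 e
      split_ifs with hwBl
      · show Hb (v + cornerUnit e) - HA ≤ η₁
        have := hb_le_of_not_interiorFace h hcA hwin hwS (hB _ hwBl) (hflux _ hwBl hwin)
        linarith
      · show Hb (v + cornerUnit e) - HA ≤ 1
        have := (h.hb_mem_Icc hA hcA hcB hwin).2
        linarith
    · show Hb w - HA ≤ 1
      have := (h.hb_mem_Icc hA hcA hcB (E.interiorFaces_subset_innerFaces hw)).2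
      linarith
  · have := hb_le_of_not_interiorFace h hcA hf hint (hB f hfBl) (hflux f hfBl hf)
    have hc1 : 0 ≤ (1 - maneuverConst) ^ J := pow_nonneg (by linarith [maneuverConst_le_one]) J
    linarith

/-- **`Hw - H_A ≤ η₁ + (1 - c_*)^J` at the sites cornering inner faces near the arc `A`**
(`Hw v = Hb f - flux ≤ Hb f`). [cite: Smirnov2010, §5 and Lemma B.3] -/
theorem hw_sub_le_near_arcA (h : IsFKPrimitive E hE Hw Hb)
    (hA : ((discreteDomainGraph E.Ω E.δ).induce E.zdArcA).Preconnected)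
    (hcA : ∀ a' ∈ E.zdArcA, (∃ k, E.IsInnerFace (faceAt a' k)) → Hw a' = Hw (DiscreteDobrushin.startCorner hE).1)
    (hcB : ∀ b ∈ E.zdArcB, (∃ k, E.IsInnerFace (faceAt b k)) →
      Hw b = Hw ((DiscreteDobrushin.startCorner hE).1 + cornerUnit (DiscreteDobrushin.startCorner hE).2))
    {Bl : Set (Site 2)} (hBlfin : (E.interiorFaces ∩ Bl).Finite)
    (hB : ∀ f ∈ Bl, ∀ j : Fin 4, f + cornerOff j ∉ E.zdArcB)
    {η₁ : ℝ} (hη₁ : 0 ≤ η₁) (hflux : ∀ f ∈ Bl, E.IsInnerFace f → ∀ j : Fin 4, dartFlux E hE (f + cornerOff j, j) ≤ η₁)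
    {K : Set (Site 2)} (hK : HoleFree K) (hSK : E.interiorFaces ∩ Bl ⊆ K)
    (c : Site 2) {k₀ : ℕ} (hk₀ : 0 < k₀) {F₀ : Site 2} (hF₀ : F₀ ∉ K) (hF₀c : F₀ ∈ mB c k₀)
    {R : ℤ} (hR : sqBox c R ⊆ Bl) (J : ℕ) (hJ : 10 * 5 ^ J * (k₀ : ℤ) ≤ R)
    {v : Site 2} {k : Fin 4} (hvk : E.IsInnerFace (faceAt v k)) (hfBl : faceAt v k ∈ Bl) (hfc : faceAt v k ∈ mB c k₀) :
    Hw v - Hw (DiscreteDobrushin.startCorner hE).1 ≤ η₁ + (1 - maneuverConst) ^ J := by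
  have hp := h (v, k) hvk
  simp only [cFace] at hp
  have h0 := dartFlux_nonneg hE (v, k)
  have := hb_sub_le_near_arcA h hA hcA hcB hBlfin hB hη₁ hflux hK hSK c hk₀ hF₀ hF₀c hR J hJ hvk hfBl hfc
  linarith

end ArcA

/-! ### The FK primitive near the arc `B`: `Hw` is close to `H_B` -/

section ArcB

variable {E : DiscreteDobrushin} [Fintype (meshDomain E.Ω E.δ)] {hE : E.IsZdAdmissible} {Hw Hb : Site 2 → ℝ}

omit [Fintype (meshDomain E.Ω E.δ)] in
/-- **Around a neighbour of an interior site all four faces are inner**, unless it lies on the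
discrete boundary: starting from the two inner faces of the interior edge and turning around the
vertex, a non-inner face would produce a face-boundary edge. [cite: Smirnov2010, §3] -/
theorem isInnerFace_faceAt_of_neighbour {v : Site 2} {e : Fin 4} (hve : E.IsInteriorEdge v e)
    (hnb : v + cornerUnit e ∉ E.zdBoundary) (j : Fin 4) : E.IsInnerFace (faceAt (v + cornerUnit e) j) := by
  set w := v + cornerUnit e with hw
  have hwdom : w ∈ meshDomain E.Ω E.δ := by
    have := (SimpleGraph.mem_edgeSet _).1 hve.mem_edgeSet
    exact (discreteDomainGraph_adj_iff.1 this).2.2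
  -- all lattice neighbours of `w` are `Ω_δ`-neighbours
  have hadj : ∀ j : Fin 4, (discreteDomainGraph E.Ω E.δ).Adj w (w + cornerUnit j) := by
    intro j
    by_contra hno
    apply hnb
    rw [DiscreteDobrushin.mem_zdBoundary_iff]; left
    rw [mem_meshBoundary_iff]
    refine ⟨hwdom, w + cornerUnit j, ?_, hno⟩
    rw [zdGraph_adj_iff]
    fin_cases j
    · exact ⟨0, Or.inl rfl⟩
    · exact ⟨1, Or.inl rfl⟩
    · exact ⟨0, Or.inr (by simp [cornerUnit])⟩
    · exact ⟨1, Or.inr (by simp [cornerUnit])⟩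
  -- turning: if `faceAt w (j+3)` is inner then so is `faceAt w j` (edge `(w, j)` between them)
  have hturn : ∀ j : Fin 4, E.IsInnerFace (faceAt w (j + 3)) → E.IsInnerFace (faceAt w j) := by
    intro j hj3
    by_contra hno
    apply hnb
    rw [DiscreteDobrushin.mem_zdBoundary_iff]; right
    refine ⟨w + cornerUnit j, hadj j, ⟨faceAt w (j + 3), hj3, isCorner_faceAt w (j + 3), ?_⟩,
      ⟨faceAt w j, hno, isCorner_faceAt w j, ?_⟩⟩
    · exact (isCorner_add_faceAt_iff w j (j + 3)).2 (Or.inr rfl)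
    · exact (isCorner_add_faceAt_iff w j j).2 (Or.inl rfl)
  -- the two inner faces of the edge `(v, e)`
  have h1 : E.IsInnerFace (faceAt w (e + 1)) := by rw [hw, faceAt_add_unit_succ]; exact hve.inner
  have h2 : E.IsInnerFace (faceAt w (e + 2)) := by rw [hw, faceAt_add_unit_add_two]; exact hve.inner'
  have h3 : E.IsInnerFace (faceAt w (e + 3)) := hturn (e + 3) (by rw [show e + 3 + 3 = e + 2 by omega]; exact h2)
  have h4 : E.IsInnerFace (faceAt w e) := hturn e h3
  -- `j` is one of `e, e+1, e+2, e+3`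
  have : j = e ∨ j = e + 1 ∨ j = e + 2 ∨ j = e + 3 := by omega
  rcases this with rfl | rfl | rfl | rfl
  · exact h4
  · exact h1
  · exact h2
  · exact h3

/-- **A non-interior neighbour `w` of an interior site, off the arc `A` and with small fluxes,
has `Hw w ≥ H_B - η₁`**: `w ∉ ∂Ω_δ` (it is neither on `B`, being the end of an interior edge,
nor on `A`), so all faces around it are inner and its non-interior edge ends on a `B`-site `b`;
then `Hb(face) = Hw b = H_B` (zero flux on `B`) and `Hw w = Hb(face) - flux ≥ H_B - η₁`.
[cite: Smirnov2010, §5 (boundary values of H near (ba))] -/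
theorem hw_ge_of_not_interiorSite (h : IsFKPrimitive E hE Hw Hb)
    (hcB : ∀ b ∈ E.zdArcB, (∃ k, E.IsInnerFace (faceAt b k)) →
      Hw b = Hw ((DiscreteDobrushin.startCorner hE).1 + cornerUnit (DiscreteDobrushin.startCorner hE).2))
    {v : Site 2} {e : Fin 4} (hve : E.IsInteriorEdge v e) (hwint : v + cornerUnit e ∉ E.interiorSites)
    (hwA : v + cornerUnit e ∉ E.zdArcA)
    {η₁ : ℝ} (hflux : ∀ j : Fin 4, dartFlux E hE (v + cornerUnit e, j) ≤ η₁) :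
    Hw ((DiscreteDobrushin.startCorner hE).1 + cornerUnit (DiscreteDobrushin.startCorner hE).2) - η₁ ≤ Hw (v + cornerUnit e) := by
  set w := v + cornerUnit e with hw
  have hwB : w ∉ E.zdArcB := hve.not_mem_zdArcB w (by rw [cSrc]; exact Sym2.mem_iff.2 (Or.inr rfl))
  have hnb : w ∉ E.zdBoundary := fun hb => by
    rcases hE.zdBoundary_subset hb with ha | hb'
    · exact hwA ha
    · exact hwB hb'
  have hinner := isInnerFace_faceAt_of_neighbour hve hnb
  have hwdom : w ∈ meshDomain E.Ω E.δ := by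
    have := (SimpleGraph.mem_edgeSet _).1 hve.mem_edgeSet
    exact (discreteDomainGraph_adj_iff.1 this).2.2
  -- a non-interior edge `(w, j)` must end on `B`
  simp only [DiscreteDobrushin.interiorSites, Set.mem_setOf_eq, not_forall] at hwint
  obtain ⟨j, hj⟩ := hwint
  have hjB : w + cornerUnit j ∈ E.zdArcB := by
    by_contra hno
    apply hj
    exact
      { mem_edgeSet := DiscreteDobrushin.adj_of_isInnerFace_faceAt (hinner j) (Or.inl rfl)
        not_mem_zdArcB := fun x hx => by
          rw [cSrc] at hx
          rcases Sym2.mem_iff.1 hx with rfl | rfl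
          · exact hwB
          · exact hno
        not_arcA := fun h' => hwA h'.1
        inner := hinner j
        inner' := hinner (j + 3) }
  -- `Hb (faceAt w j) = Hw (w + e_j) = H_B` and `Hb (faceAt w j) - Hw w = flux ≤ η₁`
  have hface : E.IsInnerFace (faceAt (w + cornerUnit j) (j + 1)) := by rw [faceAt_add_unit_succ]; exact hinner j
  have hb1 := h.hb_eq_hw_of_mem_zdArcB hjB hface
  rw [faceAt_add_unit_succ] at hb1
  have hb2 : Hw (w + cornerUnit j) = Hw ((DiscreteDobrushin.startCorner hE).1 + cornerUnit (DiscreteDobrushin.startCorner hE).2) :=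
    hcB _ hjB ⟨j + 1, hface⟩
  have hp := h (w, j) (hinner j)
  simp only [cFace] at hp
  linarith [hflux j]

/-- **`H_B - Hw ≤ η₁ + (1 - c_*)^J` on the interior sites near the arc `B`** (same scheme as near
`A`, with the subharmonic `H_B - Hw` on the interior sites). [cite: Smirnov2010, §5 and Lemma B.3] -/
theorem sub_hw_le_near_arcB (h : IsFKPrimitive E hE Hw Hb)
    (hA : ((discreteDomainGraph E.Ω E.δ).induce E.zdArcA).Preconnected)
    (hcA : ∀ a' ∈ E.zdArcA, (∃ k, E.IsInnerFace (faceAt a' k)) → Hw a' = Hw (DiscreteDobrushin.startCorner hE).1)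
    (hcB : ∀ b ∈ E.zdArcB, (∃ k, E.IsInnerFace (faceAt b k)) →
      Hw b = Hw ((DiscreteDobrushin.startCorner hE).1 + cornerUnit (DiscreteDobrushin.startCorner hE).2))
    {Bl : Set (Site 2)} (hBlfin : (E.interiorSites ∩ Bl).Finite)
    (hAfar : ∀ w ∈ Bl, w ∉ E.zdArcA)
    {η₁ : ℝ} (hη₁ : 0 ≤ η₁) (hflux : ∀ w ∈ Bl, ∀ j : Fin 4, E.IsInnerFace (faceAt w j) → dartFlux E hE (w, j) ≤ η₁)
    {K : Set (Site 2)} (hK : HoleFree K) (hSK : E.interiorSites ∩ Bl ⊆ K)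
    (c : Site 2) {k₀ : ℕ} (hk₀ : 0 < k₀) {F₀ : Site 2} (hF₀ : F₀ ∉ K) (hF₀c : F₀ ∈ mB c k₀)
    {R : ℤ} (hR : sqBox c R ⊆ Bl) (J : ℕ) (hJ : 10 * 5 ^ J * (k₀ : ℤ) ≤ R)
    {v : Site 2} (hv : v ∈ E.interiorSites) (hvBl : v ∈ Bl) (hvc : v ∈ mB c k₀) :
    Hw ((DiscreteDobrushin.startCorner hE).1 + cornerUnit (DiscreteDobrushin.startCorner hE).2) - Hw v ≤
      η₁ + (1 - maneuverConst) ^ J := by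
  classical
  set HB := Hw ((DiscreteDobrushin.startCorner hE).1 + cornerUnit (DiscreteDobrushin.startCorner hE).2) with hHB
  refine sub_le_eta_add_pow (S₀ := E.interiorSites) (Bl := Bl) (u := fun y => HB - Hw y)
    (by
      intro y hy
      have e : (fun y => HB - Hw y) = fun y => (-1 : ℝ) * Hw y + HB := by funext y; ring
      rw [e, latticeLaplacian_add_const, latticeLaplacian_const_mul]
      have := h.superharmonicOn_interiorSites hA y hy
      nlinarith [this])
    hη₁ (fun w hwS hwadj => ?_) (fun w hw => ?_) hBlfin hK hSK c hk₀ hF₀ hF₀c hR J hJ ⟨hv, hvBl⟩ hvc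
  · obtain ⟨v', hv', e, rfl⟩ := hwadj
    have hve : E.IsInteriorEdge v' e := hv'.1 e
    have hwin : ∃ k, E.IsInnerFace (faceAt (v' + cornerUnit e) k) := ⟨e + 1, by rw [faceAt_add_unit_succ]; exact hve.inner⟩
    split_ifs with hwBl
    · -- in the ball
      show HB - Hw (v' + cornerUnit e) ≤ η₁
      by_cases hb : v' + cornerUnit e ∈ E.zdBoundary
      · rcases hE.zdBoundary_subset hb with ha | hb'
        · exact absurd ha (hAfar _ hwBl)
        · rw [hcB _ hb' hwin, hHB, sub_self]; exact hη₁
      · have hall := isInnerFace_faceAt_of_neighbour hve hb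
        have := hw_ge_of_not_interiorSite h hcB hve hwS (hAfar _ hwBl) (fun j => hflux _ hwBl j (hall j))
        linarith
    · -- outside the ball: `HB - Hw w ≤ 1` from `Hw w ≥ H_A` (`w` corners the inner face of the edge)
      show HB - Hw (v' + cornerUnit e) ≤ 1
      have := (h.hw_mem_Icc hA hcA hcB hwin).1
      have hj := h.jump_startCorner
      linarith
  · show HB - Hw w ≤ 1
    have hwin : ∃ k, E.IsInnerFace (faceAt w k) := ⟨0, (hw 0).inner⟩
    have := (h.hw_mem_Icc hA hcA hcB hwin).1
    have hj := h.jump_startCorner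
    linarith

omit [Fintype (meshDomain E.Ω E.δ)] in
/-- **Around a site off the discrete boundary that corners one inner face, all four faces are
inner** (turn around the vertex: a non-inner face next to an inner one gives a face-boundary
edge). [cite: Smirnov2010, §3] -/
theorem isInnerFace_faceAt_of_not_mem_zdBoundary {v : Site 2} {k : Fin 4} (hk : E.IsInnerFace (faceAt v k))
    (hnb : v ∉ E.zdBoundary) (j : Fin 4) : E.IsInnerFace (faceAt v j) := by
  have hvdom : v ∈ meshDomain E.Ω E.δ :=
    (discreteDomainGraph_adj_iff.1 (DiscreteDobrushin.adj_of_isInnerFace_faceAt hk (Or.inl rfl))).2.1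
  have hadj : ∀ j : Fin 4, (discreteDomainGraph E.Ω E.δ).Adj v (v + cornerUnit j) := by
    intro j
    by_contra hno
    apply hnb
    rw [DiscreteDobrushin.mem_zdBoundary_iff]; left
    rw [mem_meshBoundary_iff]
    refine ⟨hvdom, v + cornerUnit j, ?_, hno⟩
    rw [zdGraph_adj_iff]
    fin_cases j
    · exact ⟨0, Or.inl rfl⟩
    · exact ⟨1, Or.inl rfl⟩
    · exact ⟨0, Or.inr (by simp [cornerUnit])⟩
    · exact ⟨1, Or.inr (by simp [cornerUnit])⟩
  have hturn : ∀ j : Fin 4, E.IsInnerFace (faceAt v (j + 3)) → E.IsInnerFace (faceAt v j) := by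
    intro j hj3
    by_contra hno
    apply hnb
    rw [DiscreteDobrushin.mem_zdBoundary_iff]; right
    refine ⟨v + cornerUnit j, hadj j, ⟨faceAt v (j + 3), hj3, isCorner_faceAt v (j + 3), ?_⟩,
      ⟨faceAt v j, hno, isCorner_faceAt v j, ?_⟩⟩
    · exact (isCorner_add_faceAt_iff v j (j + 3)).2 (Or.inr rfl)
    · exact (isCorner_add_faceAt_iff v j j).2 (Or.inl rfl)
  have h1 : E.IsInnerFace (faceAt v (k + 1)) := hturn (k + 1) (by rw [show k + 1 + 3 = k by omega]; exact hk)
  have h2 : E.IsInnerFace (faceAt v (k + 2)) := hturn (k + 2) (by rw [show k + 2 + 3 = k + 1 by omega]; exact h1)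
  have h3 : E.IsInnerFace (faceAt v (k + 3)) := hturn (k + 3) (by rw [show k + 3 + 3 = k + 2 by omega]; exact h2)
  have : j = k ∨ j = k + 1 ∨ j = k + 2 ∨ j = k + 3 := by omega
  rcases this with rfl | rfl | rfl | rfl
  · exact hk
  · exact h1
  · exact h2
  · exact h3

/-- **A non-interior site off the discrete boundary, cornering an inner face and with small
fluxes, has `Hw ≥ H_B - η₁`.** [cite: Smirnov2010, §5 (boundary values of H near (ba))] -/
theorem hw_ge_of_not_interiorSite' (h : IsFKPrimitive E hE Hw Hb)
    (hcB : ∀ b ∈ E.zdArcB, (∃ k, E.IsInnerFace (faceAt b k)) →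
      Hw b = Hw ((DiscreteDobrushin.startCorner hE).1 + cornerUnit (DiscreteDobrushin.startCorner hE).2))
    {v : Site 2} {k : Fin 4} (hk : E.IsInnerFace (faceAt v k)) (hvint : v ∉ E.interiorSites) (hnb : v ∉ E.zdBoundary)
    {η₁ : ℝ} (hflux : ∀ j : Fin 4, dartFlux E hE (v, j) ≤ η₁) :
    Hw ((DiscreteDobrushin.startCorner hE).1 + cornerUnit (DiscreteDobrushin.startCorner hE).2) - η₁ ≤ Hw v := by
  have hvA : v ∉ E.zdArcA := fun h' => hnb (E.zdArcA_subset_zdBoundary h')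
  have hvB : v ∉ E.zdArcB := fun h' => hnb (E.zdArcB_subset_zdBoundary h')
  have hinner := isInnerFace_faceAt_of_not_mem_zdBoundary hk hnb
  simp only [DiscreteDobrushin.interiorSites, Set.mem_setOf_eq, not_forall] at hvint
  obtain ⟨j, hj⟩ := hvint
  have hjB : v + cornerUnit j ∈ E.zdArcB := by
    by_contra hno
    apply hj
    exact
      { mem_edgeSet := DiscreteDobrushin.adj_of_isInnerFace_faceAt (hinner j) (Or.inl rfl)
        not_mem_zdArcB := fun x hx => by
          rw [cSrc] at hx
          rcases Sym2.mem_iff.1 hx with rfl | rfl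
          · exact hvB
          · exact hno
        not_arcA := fun h' => hvA h'.1
        inner := hinner j
        inner' := hinner (j + 3) }
  have hface : E.IsInnerFace (faceAt (v + cornerUnit j) (j + 1)) := by rw [faceAt_add_unit_succ]; exact hinner j
  have hb1 := h.hb_eq_hw_of_mem_zdArcB hjB hface
  rw [faceAt_add_unit_succ] at hb1
  have hb2 : Hw (v + cornerUnit j) = Hw ((DiscreteDobrushin.startCorner hE).1 + cornerUnit (DiscreteDobrushin.startCorner hE).2) :=
    hcB _ hjB ⟨j + 1, hface⟩
  have hp := h (v, j) (hinner j)
  simp only [cFace] at hp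
  linarith [hflux j]

end ArcB

end Literature.Probability.LatticeModels
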